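import Mathlib
import Literature.Analysis.FluidPDE.RieszPressureModConst
import HarnessLib

/-!
# Crux `EulerZoomLiouville.PowerGaugeEulerLiouville` (stmt-NavierStokesRegularity-19832), t60-ΠLOG piece S4 (nsreg-p2 `r58/Sketch58c.lean`
# `RieszModConst`), part 1/3: KERNEL AND BUDGET TOOLS for the Riesz pressure modulo constants of a field with the DYADIC `L²` velocity budget

Route №10 `EulerZoomLiouville` (NavierStokesRegularity), crux E = stmt-NavierStokesRegularity-19832; width seat ns-ezl-w1 g10 under the LEAD ns-typeII-p2
(KEY S58c-4; instrument piece of nsreg-p2's t60-ΠLOG «pressure budget with the logarithm, scale by scale, modulo constants»).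

The witness of S4 is `Q = −Q₁^{½,1}[V] − farPotentialMod ½ 1 0 V` (the tree's near potential and renormalised far potential, `RieszPressureModConst`,
with cutoff radii `(½, 1)`).  The tree types the renormalised far potential for BOUNDED fields; here the boundedness is replaced by the velocity budget
`∫_{B_R}|V|² ≤ A R^{1−2ρ}` (`R ≥ 1`, `ρ > −3/2`).  This file supplies the three inputs:

* `exists_norm_fderiv2_newtonFar_sub_le_of_two_mul_le` — the SHARP two-centre bound in operator norm, `‖D²Γ∞(x−y) − D²Γ∞(x₀−y)‖ ≤ M‖x−x₀‖(1+|y−x₀|)⁻⁴`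
  for `2‖x−x₀‖ ≤ ‖y−x₀‖` (mean value inequality on the ball `B̄(x₀, ‖x−x₀‖)` with the decay `‖D³Γ∞‖ ≤ M(1+|·|)⁻⁴` of the tree; no `(1+ρ)⁴` loss);
* `setIntegral_tail_normSq_weight_le_of_budget` — the DYADIC TAIL `∫_{|y|≥2R} |V|²(1+|y|)⁻⁴ ≤ C_ρ A R^{−3−2ρ}` (`R ≥ 1`), `C_ρ = 2⁻⁴4^{1−2ρ}/(1−2^{−3−2ρ})`, by summing the
  budget over the shells `[2^{k+1}R, 2^{k+2}R)` (geometric series, ratio `2^{−3−2ρ} < 1`), with the integrability statements that go with it;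
* `integrable_farIntegrand_of_budget`, `continuous_farPotentialMod_of_budget` — the renormalised far integrand
  `(D²Γ∞(x−y) − D²Γ∞(−y))(V y, V y)` is integrable for every `x` and the renormalised far potential is continuous (dominated convergence with the tree's
  mean-value majorant `exists_norm_fderiv2_newtonFar_sub_sub_le` against `(1+|y|)⁻⁴|V|² ∈ L¹`).

WHAT THIS IS NOT: not NS, not E, not the crux: tools for an instrument (t60-ΠLOG) bearing on the bookkeeping of 19832; 19832 OPEN; no summit statement is
proved by this file.
[cite: GilbargTrudinger2001, (2.14) and Lemma 4.2; Seregin2014, §6.2 Lemma 6.5; Stein1970, Ch. II §2 Thm 1 (b)]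
-/

noncomputable section

-- flat `Theorems/<Route><Decl>…` files of one crux share the namespace of the crux (tree convention)
set_option linter.dupNamespace false

open MeasureTheory Set Filter Topology Metric Function
open scoped NNReal ENNReal RealInnerProductSpace ContDiff

namespace Summit.NavierStokesRegularity.NavierStokesRegularity.Theorems.PowerGaugeEulerLiouville.PressureSeam

open Literature.Analysis Literature.Analysis.FluidPDE
open Literature.Analysis.FluidPDE.FourierNS (HasDecay)
open Literature.Analysis.FluidPDE.RieszPressureModConst

-- nested operator types `ℝ³ →L[ℝ] ℝ³ →L[ℝ] ℝ³ →L[ℝ] ℝ`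
set_option maxSynthPendingDepth 3

variable {r₀ r₁ : ℝ}

/-! ### The sharp two-centre bound for `D²Γ∞` -/

/-- `(1 + t/2)⁻⁴ ≤ 16 (1 + t)⁻⁴` for `t ≥ 0`. [folklore] -/
theorem inv_one_add_half_pow_four_le {t : ℝ} (ht : 0 ≤ t) :
    ((1 + t / 2) ^ 4)⁻¹ ≤ 16 * ((1 + t) ^ 4)⁻¹ := by
  have h1 : 0 < 1 + t / 2 := by positivity
  have h2 : 0 < 1 + t := by positivity
  rw [← one_div, ← one_div, ← div_eq_mul_one_div, div_le_div_iff₀ (by positivity) (by positivity), one_mul]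
  have : (1 + t) ^ 4 ≤ (2 * (1 + t / 2)) ^ 4 := pow_le_pow_left₀ h2.le (by linarith) 4
  nlinarith [this]

/-- **THE SHARP TWO-CENTRE BOUND** (Hörmander's gradient condition for the kernel `D²Γ∞` of the renormalised far potential, operator norm): there is
`M ≥ 0` with `‖D²Γ∞(x−y) − D²Γ∞(x₀−y)‖ ≤ M ‖x−x₀‖ (1+‖y−x₀‖)⁻⁴` whenever `2‖x−x₀‖ ≤ ‖y−x₀‖` (mean value inequality on the closed ball
`B̄(x₀, ‖x−x₀‖)`, on which `‖ξ − y‖ ≥ ‖y−x₀‖/2`, against the decay `‖D³Γ∞(ζ)‖ ≤ M₀(1+‖ζ‖)⁻⁴` of `exists_hasDecay_four_fderiv3_newtonFar`).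
[cite: GilbargTrudinger2001, (2.14); Stein1970, Ch. II §2 Thm 1 condition (b)] -/
theorem exists_norm_fderiv2_newtonFar_sub_le_of_two_mul_le (h₀ : 0 < r₀) (h₁ : r₀ < r₁) :
    ∃ M, 0 ≤ M ∧ ∀ x₀ x y : EuclideanSpace ℝ (Fin 3), 2 * ‖x - x₀‖ ≤ ‖y - x₀‖ →
      ‖fderiv ℝ (fderiv ℝ (newtonFar r₀ r₁)) (x - y) - fderiv ℝ (fderiv ℝ (newtonFar r₀ r₁)) (x₀ - y)‖ ≤
        M * ‖x - x₀‖ * ((1 + ‖y - x₀‖) ^ 4)⁻¹ := by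
  obtain ⟨M, hM⟩ := exists_hasDecay_four_fderiv3_newtonFar h₀ h₁
  have hM0 : 0 ≤ M := hM.nonneg
  set K := fderiv ℝ (fderiv ℝ (newtonFar r₀ r₁)) with hK
  have hKd : Differentiable ℝ K := (contDiff_fderiv2_newtonFar h₀ h₁).differentiable two_ne_zero
  refine ⟨16 * M, by positivity, fun x₀ x y hxy => ?_⟩
  set d : ℝ := ‖x - x₀‖ with hd
  have hd0 : 0 ≤ d := norm_nonneg _
  -- the function `ξ ↦ K (ξ - y)` on the convex set `closedBall x₀ d`
  have hdiff : ∀ ξ ∈ closedBall x₀ d, DifferentiableAt ℝ (fun ξ => K (ξ - y)) ξ := fun ξ _ =>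
    (hKd (ξ - y)).comp ξ ((differentiableAt_id).sub (differentiableAt_const y))
  have hbound : ∀ ξ ∈ closedBall x₀ d, ‖fderiv ℝ (fun ξ => K (ξ - y)) ξ‖ ≤ 16 * M * ((1 + ‖y - x₀‖) ^ 4)⁻¹ := by
    intro ξ hξ
    rw [mem_closedBall, dist_eq_norm] at hξ
    have e : fderiv ℝ (fun ξ => K (ξ - y)) ξ = fderiv ℝ K (ξ - y) := by
      simpa only [sub_eq_add_neg] using fderiv_comp_add_right (f := K) (x := ξ) (-y)
    rw [e]
    -- `‖ξ − y‖ ≥ ‖y − x₀‖ − ‖ξ − x₀‖ ≥ ‖y − x₀‖/2`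
    have hfar : ‖y - x₀‖ / 2 ≤ ‖ξ - y‖ := by
      have h1 : ‖y - x₀‖ ≤ ‖y - ξ‖ + ‖ξ - x₀‖ := norm_sub_le_norm_sub_add_norm_sub y ξ x₀
      rw [norm_sub_rev y ξ] at h1
      linarith
    have hy0 : 0 ≤ ‖y - x₀‖ := norm_nonneg _
    calc ‖fderiv ℝ K (ξ - y)‖ ≤ M * ((1 + ‖ξ - y‖) ^ 4)⁻¹ := hM (ξ - y)
      _ ≤ M * ((1 + ‖y - x₀‖ / 2) ^ 4)⁻¹ := by
          refine mul_le_mul_of_nonneg_left ?_ hM0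
          have hp : 0 < 1 + ‖y - x₀‖ / 2 := by positivity
          exact inv_anti₀ (pow_pos hp 4) (pow_le_pow_left₀ hp.le (by linarith) 4)
      _ ≤ M * (16 * ((1 + ‖y - x₀‖) ^ 4)⁻¹) :=
          mul_le_mul_of_nonneg_left (inv_one_add_half_pow_four_le hy0) hM0
      _ = 16 * M * ((1 + ‖y - x₀‖) ^ 4)⁻¹ := by ring
  have h := (convex_closedBall x₀ d).norm_image_sub_le_of_norm_fderiv_le hdiff hbound
    (mem_closedBall_self hd0) (by rw [mem_closedBall, dist_eq_norm])
  calc ‖K (x - y) - K (x₀ - y)‖ ≤ 16 * M * ((1 + ‖y - x₀‖) ^ 4)⁻¹ * ‖x - x₀‖ := h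
    _ = 16 * M * ‖x - x₀‖ * ((1 + ‖y - x₀‖) ^ 4)⁻¹ := by ring


/-! ### The dyadic tail of the velocity budget -/

/-- The weight `(1+|y|)⁻⁴ |V y|²` is non-negative and continuous for continuous `V`. [folklore] -/
theorem continuous_normSq_weight {V : EuclideanSpace ℝ (Fin 3) → EuclideanSpace ℝ (Fin 3)} (hV : Continuous V) :
    Continuous fun y : EuclideanSpace ℝ (Fin 3) => ‖V y‖ ^ 2 * ((1 + ‖y‖) ^ 4)⁻¹ :=
  ((hV.norm).pow 2).mul
    ((show Continuous (fun y : EuclideanSpace ℝ (Fin 3) => (1 + ‖y‖) ^ 4) by fun_prop).inv₀ fun y => by positivity)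

/-- One dyadic shell of the budget: for `r ≥ 1`, `∫_{r ≤ |y| < 2r} |V|²(1+|y|)⁻⁴ ≤ A·2^{1−2ρ}·r^{−3−2ρ}` (as an `ℝ≥0∞` bound on the lower integral).
[folklore] -/
theorem lintegral_shell_normSq_weight_le {V : EuclideanSpace ℝ (Fin 3) → EuclideanSpace ℝ (Fin 3)} (hV : Continuous V) {ρ A : ℝ}
    (hA : ∀ R : ℝ, 1 ≤ R → ∫ y in ball (0 : EuclideanSpace ℝ (Fin 3)) R, ‖V y‖ ^ 2 ≤ A * R ^ (1 - 2 * ρ))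
    {r : ℝ} (hr : 1 ≤ r) :
    ∫⁻ y in {y : EuclideanSpace ℝ (Fin 3) | r ≤ ‖y‖ ∧ ‖y‖ < 2 * r}, ENNReal.ofReal (‖V y‖ ^ 2 * ((1 + ‖y‖) ^ 4)⁻¹) ≤
      ENNReal.ofReal (A * 2 ^ (1 - 2 * ρ) * r ^ (-3 - 2 * ρ)) := by
  have hr0 : 0 < r := by linarith
  set T := {y : EuclideanSpace ℝ (Fin 3) | r ≤ ‖y‖ ∧ ‖y‖ < 2 * r} with hT
  -- on the shell the weight is at most `r⁻⁴`
  have hpt : ∀ y ∈ T, ENNReal.ofReal (‖V y‖ ^ 2 * ((1 + ‖y‖) ^ 4)⁻¹) ≤ ENNReal.ofReal (‖V y‖ ^ 2 * (r ^ 4)⁻¹) := by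
    intro y hy
    refine ENNReal.ofReal_le_ofReal (mul_le_mul_of_nonneg_left ?_ (sq_nonneg _))
    exact inv_anti₀ (pow_pos hr0 4) (pow_le_pow_left₀ hr0.le (by linarith [hy.1, norm_nonneg y]) 4)
  have hTsub : T ⊆ ball (0 : EuclideanSpace ℝ (Fin 3)) (2 * r) := fun y hy => by
    rw [mem_ball_zero_iff]; exact hy.2
  have hTm : MeasurableSet T :=
    (measurableSet_le measurable_const measurable_norm).inter (measurableSet_lt measurable_norm measurable_const)
  -- integrate `|V|²` over the ball `B(0, 2r)`
  have hint : IntegrableOn (fun y => ‖V y‖ ^ 2 * (r ^ 4)⁻¹) (ball (0 : EuclideanSpace ℝ (Fin 3)) (2 * r)) volume :=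
    ((((hV.norm).pow 2).mul continuous_const).continuousOn.integrableOn_compact (isCompact_closedBall 0 (2 * r))).mono_set
      ball_subset_closedBall
  have hnn : 0 ≤ᵐ[volume.restrict (ball (0 : EuclideanSpace ℝ (Fin 3)) (2 * r))] fun y => ‖V y‖ ^ 2 * (r ^ 4)⁻¹ :=
    Eventually.of_forall fun y => by positivity
  calc ∫⁻ y in T, ENNReal.ofReal (‖V y‖ ^ 2 * ((1 + ‖y‖) ^ 4)⁻¹)
      ≤ ∫⁻ y in T, ENNReal.ofReal (‖V y‖ ^ 2 * (r ^ 4)⁻¹) := setLIntegral_mono' hTm hpt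
    _ ≤ ∫⁻ y in ball (0 : EuclideanSpace ℝ (Fin 3)) (2 * r), ENNReal.ofReal (‖V y‖ ^ 2 * (r ^ 4)⁻¹) :=
        lintegral_mono_set hTsub
    _ = ENNReal.ofReal (∫ y in ball (0 : EuclideanSpace ℝ (Fin 3)) (2 * r), ‖V y‖ ^ 2 * (r ^ 4)⁻¹) :=
        (ofReal_integral_eq_lintegral_ofReal hint hnn).symm
    _ ≤ ENNReal.ofReal (A * 2 ^ (1 - 2 * ρ) * r ^ (-3 - 2 * ρ)) := by
        refine ENNReal.ofReal_le_ofReal ?_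
        rw [integral_mul_const]
        have h2r : 1 ≤ 2 * r := by linarith
        have hb := hA (2 * r) h2r
        calc (∫ y in ball (0 : EuclideanSpace ℝ (Fin 3)) (2 * r), ‖V y‖ ^ 2) * (r ^ 4)⁻¹
            ≤ A * (2 * r) ^ (1 - 2 * ρ) * (r ^ 4)⁻¹ := mul_le_mul_of_nonneg_right hb (by positivity)
          _ = A * 2 ^ (1 - 2 * ρ) * r ^ (-3 - 2 * ρ) := by
              rw [Real.mul_rpow (by norm_num) hr0.le]
              have e : r ^ (-3 - 2 * ρ) = r ^ (1 - 2 * ρ) * (r ^ 4)⁻¹ := by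
                rw [← Real.rpow_natCast r 4, ← Real.rpow_neg hr0.le, ← Real.rpow_add hr0]
                norm_num; ring_nf
              rw [e]; ring

/-- Every point with `|y| ≥ 2R` (`R > 0`) lies in a dyadic shell `[2^{k+1}R, 2^{k+2}R)`. [folklore] -/
theorem subset_iUnion_dyadicShell {R : ℝ} (hR : 0 < R) :
    {y : EuclideanSpace ℝ (Fin 3) | 2 * R ≤ ‖y‖} ⊆
      ⋃ k : ℕ, {y : EuclideanSpace ℝ (Fin 3) | 2 ^ (k + 1) * R ≤ ‖y‖ ∧ ‖y‖ < 2 * (2 ^ (k + 1) * R)} := by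
  intro y hy
  rw [mem_setOf_eq] at hy
  have h2R : 0 < 2 * R := by positivity
  have ht : 1 ≤ ‖y‖ / (2 * R) := by rwa [le_div_iff₀ h2R, one_mul]
  obtain ⟨n, hn1, hn2⟩ := exists_nat_pow_near ht one_lt_two
  refine mem_iUnion.2 ⟨n, ?_, ?_⟩
  · have := (le_div_iff₀ h2R).1 hn1
    calc (2 : ℝ) ^ (n + 1) * R = 2 ^ n * (2 * R) := by ring
      _ ≤ ‖y‖ := this
  · have := (div_lt_iff₀ h2R).1 hn2
    calc ‖y‖ < 2 ^ (n + 1) * (2 * R) := this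
      _ = 2 * (2 ^ (n + 1) * R) := by ring

/-- **THE DYADIC TAIL OF THE VELOCITY BUDGET**: if `∫_{B_R}|V|² ≤ A R^{1−2ρ}` for `R ≥ 1` and `ρ > −3/2`, then for `R ≥ 1`
`∫_{|y| ≥ 2R} |V|² (1+|y|)⁻⁴ ≤ C_ρ · A · R^{−3−2ρ}` with `C_ρ = 2^{1−2ρ}·2^{−3−2ρ}/(1 − 2^{−3−2ρ})` (sum of the budget over the shells `[2^{k+1}R, 2^{k+2}R)`,
a geometric series of ratio `2^{−3−2ρ} < 1`), stated on the lower integral. [folklore; cf. Stein1970 Ch. II §2 (dyadic decomposition)] -/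
theorem lintegral_tail_normSq_weight_le {V : EuclideanSpace ℝ (Fin 3) → EuclideanSpace ℝ (Fin 3)} (hV : Continuous V) {ρ A : ℝ}
    (hρ : -3 / 2 < ρ)
    (hA : ∀ R : ℝ, 1 ≤ R → ∫ y in ball (0 : EuclideanSpace ℝ (Fin 3)) R, ‖V y‖ ^ 2 ≤ A * R ^ (1 - 2 * ρ))
    {R : ℝ} (hR : 1 ≤ R) :
    ∫⁻ y in {y : EuclideanSpace ℝ (Fin 3) | 2 * R ≤ ‖y‖}, ENNReal.ofReal (‖V y‖ ^ 2 * ((1 + ‖y‖) ^ 4)⁻¹) ≤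
      ENNReal.ofReal (A * 2 ^ (1 - 2 * ρ) * R ^ (-3 - 2 * ρ) * ((2 : ℝ) ^ (-3 - 2 * ρ) / (1 - 2 ^ (-3 - 2 * ρ)))) := by
  have hR0 : 0 < R := by linarith
  have hA0 : 0 ≤ A := by
    have h := hA 1 le_rfl
    rw [Real.one_rpow, mul_one] at h
    exact (integral_nonneg fun y => by positivity).trans h
  set q : ℝ := (2 : ℝ) ^ (-3 - 2 * ρ) with hq
  have hq0 : 0 < q := Real.rpow_pos_of_pos two_pos _
  have hq1 : q < 1 := Real.rpow_lt_one_of_one_lt_of_neg one_lt_two (by linarith)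
  set c₀ : ℝ := A * 2 ^ (1 - 2 * ρ) * R ^ (-3 - 2 * ρ) with hc₀
  have hc₀0 : 0 ≤ c₀ := by positivity
  set T : ℕ → Set (EuclideanSpace ℝ (Fin 3)) := fun k =>
    {y | 2 ^ (k + 1) * R ≤ ‖y‖ ∧ ‖y‖ < 2 * (2 ^ (k + 1) * R)} with hT
  -- shell bounds
  have hshell : ∀ k : ℕ, ∫⁻ y in T k, ENNReal.ofReal (‖V y‖ ^ 2 * ((1 + ‖y‖) ^ 4)⁻¹) ≤ ENNReal.ofReal (c₀ * q ^ (k + 1)) := by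
    intro k
    have hr : 1 ≤ 2 ^ (k + 1) * R := by
      have : (1 : ℝ) ≤ 2 ^ (k + 1) := one_le_pow₀ (by norm_num)
      nlinarith
    refine (lintegral_shell_normSq_weight_le hV hA hr).trans (le_of_eq ?_)
    congr 1
    rw [hc₀, hq, Real.mul_rpow (by positivity) hR0.le, ← Real.rpow_natCast (2 : ℝ) (k + 1),
      ← Real.rpow_mul (by norm_num : (0 : ℝ) ≤ 2), ← Real.rpow_mul_natCast (by norm_num : (0 : ℝ) ≤ 2)]
    push_cast
    ring_nf
  -- sum of the geometric series
  have hsum : ∑' k : ℕ, ENNReal.ofReal (c₀ * q ^ (k + 1)) = ENNReal.ofReal (c₀ * (q / (1 - q))) := by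
    have e : ∀ k : ℕ, ENNReal.ofReal (c₀ * q ^ (k + 1)) = ENNReal.ofReal (c₀ * q) * ENNReal.ofReal q ^ k := by
      intro k
      rw [pow_succ', ← mul_assoc, ENNReal.ofReal_mul (by positivity), ENNReal.ofReal_pow hq0.le]
    simp_rw [e]
    rw [ENNReal.tsum_mul_left, ENNReal.tsum_geometric, ← ENNReal.ofReal_one, ← ENNReal.ofReal_sub _ hq0.le,
      ← div_eq_mul_inv, ← ENNReal.ofReal_div_of_pos (by linarith), mul_div_assoc]
  calc ∫⁻ y in {y : EuclideanSpace ℝ (Fin 3) | 2 * R ≤ ‖y‖}, ENNReal.ofReal (‖V y‖ ^ 2 * ((1 + ‖y‖) ^ 4)⁻¹)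
      ≤ ∫⁻ y in ⋃ k, T k, ENNReal.ofReal (‖V y‖ ^ 2 * ((1 + ‖y‖) ^ 4)⁻¹) :=
        lintegral_mono_set (subset_iUnion_dyadicShell hR0)
    _ ≤ ∑' k, ∫⁻ y in T k, ENNReal.ofReal (‖V y‖ ^ 2 * ((1 + ‖y‖) ^ 4)⁻¹) := lintegral_iUnion_le _ _
    _ ≤ ∑' k, ENNReal.ofReal (c₀ * q ^ (k + 1)) := ENNReal.tsum_le_tsum hshell
    _ = ENNReal.ofReal (c₀ * (q / (1 - q))) := hsum
    _ = _ := by rw [hc₀, hq]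

/-- The tail constant `C_ρ = 2^{1−2ρ}·2^{−3−2ρ}/(1 − 2^{−3−2ρ})` of `lintegral_tail_normSq_weight_le` is non-negative for `ρ > −3/2`
(it is written out in every statement; no definition is introduced). [folklore] -/
theorem tailConst_nonneg {ρ : ℝ} (hρ : -3 / 2 < ρ) :
    0 ≤ (2 : ℝ) ^ (1 - 2 * ρ) * ((2 : ℝ) ^ (-3 - 2 * ρ) / (1 - 2 ^ (-3 - 2 * ρ))) := by
  have hq0 : 0 < (2 : ℝ) ^ (-3 - 2 * ρ) := Real.rpow_pos_of_pos two_pos _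
  have hq1 : (2 : ℝ) ^ (-3 - 2 * ρ) < 1 := Real.rpow_lt_one_of_one_lt_of_neg one_lt_two (by linarith)
  exact mul_nonneg (Real.rpow_nonneg (by norm_num) _) (div_nonneg hq0.le (by linarith))

/-- **THE DYADIC TAIL, real form with integrability**: under the budget (`ρ > −3/2`, `R ≥ 1`), `|V|²(1+|y|)⁻⁴` is integrable on `{|y| ≥ 2R}` and
`∫_{|y|≥2R} |V|²(1+|y|)⁻⁴ ≤ C_ρ · A · R^{−3−2ρ}`. [folklore] -/
theorem setIntegral_tail_normSq_weight_le_of_budget {V : EuclideanSpace ℝ (Fin 3) → EuclideanSpace ℝ (Fin 3)} (hV : Continuous V) {ρ A : ℝ}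
    (hρ : -3 / 2 < ρ)
    (hA : ∀ R : ℝ, 1 ≤ R → ∫ y in ball (0 : EuclideanSpace ℝ (Fin 3)) R, ‖V y‖ ^ 2 ≤ A * R ^ (1 - 2 * ρ))
    {R : ℝ} (hR : 1 ≤ R) :
    IntegrableOn (fun y : EuclideanSpace ℝ (Fin 3) => ‖V y‖ ^ 2 * ((1 + ‖y‖) ^ 4)⁻¹) {y | 2 * R ≤ ‖y‖} volume ∧
      ∫ y in {y : EuclideanSpace ℝ (Fin 3) | 2 * R ≤ ‖y‖}, ‖V y‖ ^ 2 * ((1 + ‖y‖) ^ 4)⁻¹ ≤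
        (2 : ℝ) ^ (1 - 2 * ρ) * ((2 : ℝ) ^ (-3 - 2 * ρ) / (1 - 2 ^ (-3 - 2 * ρ))) * A * R ^ (-3 - 2 * ρ) := by
  have hR0 : 0 < R := by linarith
  have hA0 : 0 ≤ A := by
    have h := hA 1 le_rfl
    rw [Real.one_rpow, mul_one] at h
    exact (integral_nonneg fun y => by positivity).trans h
  set f : EuclideanSpace ℝ (Fin 3) → ℝ := fun y => ‖V y‖ ^ 2 * ((1 + ‖y‖) ^ 4)⁻¹ with hf
  have hf0 : ∀ y, 0 ≤ f y := fun y => by positivity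
  have hfc : Continuous f := continuous_normSq_weight hV
  set S := {y : EuclideanSpace ℝ (Fin 3) | 2 * R ≤ ‖y‖} with hS
  have hSm : MeasurableSet S := measurableSet_le measurable_const measurable_norm
  have htail := lintegral_tail_normSq_weight_le hV hρ hA hR
  have hB0 : 0 ≤ (2 : ℝ) ^ (1 - 2 * ρ) * ((2 : ℝ) ^ (-3 - 2 * ρ) / (1 - 2 ^ (-3 - 2 * ρ))) * A * R ^ (-3 - 2 * ρ) :=
    mul_nonneg (mul_nonneg (tailConst_nonneg hρ) hA0) (Real.rpow_nonneg hR0.le _)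
  have heqB : A * 2 ^ (1 - 2 * ρ) * R ^ (-3 - 2 * ρ) * ((2 : ℝ) ^ (-3 - 2 * ρ) / (1 - 2 ^ (-3 - 2 * ρ))) =
      (2 : ℝ) ^ (1 - 2 * ρ) * ((2 : ℝ) ^ (-3 - 2 * ρ) / (1 - 2 ^ (-3 - 2 * ρ))) * A * R ^ (-3 - 2 * ρ) := by
    ring
  rw [heqB] at htail
  -- the lower integral of `‖f‖ₑ` is finite
  have henorm : ∀ y, ‖f y‖ₑ = ENNReal.ofReal (f y) := fun y => by
    rw [Real.enorm_eq_ofReal (hf0 y)]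
  have hlt : ∫⁻ y in S, ‖f y‖ₑ < ⊤ := by
    simp_rw [henorm]
    exact htail.trans_lt ENNReal.ofReal_lt_top
  have hint : IntegrableOn f S volume := ⟨hfc.aestronglyMeasurable.restrict, hlt⟩
  refine ⟨hint, ?_⟩
  rw [integral_eq_lintegral_of_nonneg_ae (Eventually.of_forall hf0) hfc.aestronglyMeasurable.restrict]
  exact ENNReal.toReal_le_of_le_ofReal hB0 htail

/-- **Global integrability of `(1+|y|)⁻⁴|V|²`** under the budget (`ρ > −3/2`): the ball `B(0,3)` by continuity, the tail `{|y| ≥ 2}` by the dyadic bound.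
[folklore] -/
theorem integrable_normSq_weight_of_budget {V : EuclideanSpace ℝ (Fin 3) → EuclideanSpace ℝ (Fin 3)} (hV : Continuous V) {ρ A : ℝ}
    (hρ : -3 / 2 < ρ)
    (hA : ∀ R : ℝ, 1 ≤ R → ∫ y in ball (0 : EuclideanSpace ℝ (Fin 3)) R, ‖V y‖ ^ 2 ≤ A * R ^ (1 - 2 * ρ)) :
    Integrable (fun y : EuclideanSpace ℝ (Fin 3) => ‖V y‖ ^ 2 * ((1 + ‖y‖) ^ 4)⁻¹) volume := by
  have h1 : IntegrableOn (fun y : EuclideanSpace ℝ (Fin 3) => ‖V y‖ ^ 2 * ((1 + ‖y‖) ^ 4)⁻¹)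
      (closedBall (0 : EuclideanSpace ℝ (Fin 3)) 3) volume :=
    (continuous_normSq_weight hV).continuousOn.integrableOn_compact (isCompact_closedBall 0 3)
  have h2 := (setIntegral_tail_normSq_weight_le_of_budget hV hρ hA le_rfl).1
  have hcover : (univ : Set (EuclideanSpace ℝ (Fin 3))) ⊆ closedBall (0 : EuclideanSpace ℝ (Fin 3)) 3 ∪ {y | 2 * (1 : ℝ) ≤ ‖y‖} := by
    intro y _
    by_cases hy : ‖y‖ ≤ 3
    · exact Or.inl (mem_closedBall_zero_iff.2 hy)
    · exact Or.inr (by rw [mem_setOf_eq]; linarith)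
  exact (integrableOn_univ.1 ((h1.union h2).mono_set hcover))


/-! ### The renormalised far potential of a field with the velocity budget -/

/-- **Pointwise majorant of the renormalised far integrand** (general base point `x₀`, both centres in `B̄(0, ρ)`):
`‖(D²Γ∞(x−y) − D²Γ∞(x₀−y))(V y, V y)‖ ≤ M(1+ρ)⁴ ‖x−x₀‖ · (1+|y|)⁻⁴|V y|²` (the tree's mean-value majorant). [cite: GilbargTrudinger2001, (2.14)] -/
theorem exists_norm_farIntegrand_le (h₀ : 0 < r₀) (h₁ : r₀ < r₁) :
    ∃ M, 0 ≤ M ∧ ∀ (V : EuclideanSpace ℝ (Fin 3) → EuclideanSpace ℝ (Fin 3)) (ρ : ℝ) (x x₀ y : EuclideanSpace ℝ (Fin 3)),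
      ‖x‖ ≤ ρ → ‖x₀‖ ≤ ρ →
      ‖(fderiv ℝ (fderiv ℝ (newtonFar r₀ r₁)) (x - y) - fderiv ℝ (fderiv ℝ (newtonFar r₀ r₁)) (x₀ - y)) (V y) (V y)‖ ≤
        M * (1 + ρ) ^ 4 * ‖x - x₀‖ * (‖V y‖ ^ 2 * ((1 + ‖y‖) ^ 4)⁻¹) := by
  obtain ⟨M, hM0, hM⟩ := exists_norm_fderiv2_newtonFar_sub_sub_le h₀ h₁
  refine ⟨M, hM0, fun V ρ x x₀ y hx hx₀ => ?_⟩
  set D := fderiv ℝ (fderiv ℝ (newtonFar r₀ r₁)) (x - y) - fderiv ℝ (fderiv ℝ (newtonFar r₀ r₁)) (x₀ - y) with hD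
  calc ‖D (V y) (V y)‖ ≤ ‖D (V y)‖ * ‖V y‖ := ContinuousLinearMap.le_opNorm _ _
    _ ≤ ‖D‖ * ‖V y‖ * ‖V y‖ := by gcongr; exact ContinuousLinearMap.le_opNorm _ _
    _ ≤ (M * (1 + ρ) ^ 4 * ‖x - x₀‖ * ((1 + ‖y‖) ^ 4)⁻¹) * ‖V y‖ * ‖V y‖ := by
        gcongr
        exact hM ρ x x₀ y hx hx₀
    _ = M * (1 + ρ) ^ 4 * ‖x - x₀‖ * (‖V y‖ ^ 2 * ((1 + ‖y‖) ^ 4)⁻¹) := by ring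

/-- The renormalised far integrand is continuous in `y` (for each `x`, `x₀`). [folklore] -/
theorem continuous_farIntegrand (h₀ : 0 < r₀) (h₁ : r₀ < r₁)
    {V : EuclideanSpace ℝ (Fin 3) → EuclideanSpace ℝ (Fin 3)} (hV : Continuous V) (x₀ x : EuclideanSpace ℝ (Fin 3)) :
    Continuous fun y => (fderiv ℝ (fderiv ℝ (newtonFar r₀ r₁)) (x - y) -
      fderiv ℝ (fderiv ℝ (newtonFar r₀ r₁)) (x₀ - y)) (V y) (V y) := by
  have hKc : Continuous (fderiv ℝ (fderiv ℝ (newtonFar r₀ r₁))) :=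
    (contDiff_fderiv2_newtonFar h₀ h₁).continuous
  exact (((hKc.comp (continuous_const.sub continuous_id)).sub
    (hKc.comp (continuous_const.sub continuous_id))).clm_apply hV).clm_apply hV

/-- The renormalised far integrand is jointly continuous in `(x, y)`. [folklore] -/
theorem continuous_farIntegrand_uncurry (h₀ : 0 < r₀) (h₁ : r₀ < r₁)
    {V : EuclideanSpace ℝ (Fin 3) → EuclideanSpace ℝ (Fin 3)} (hV : Continuous V) (x₀ : EuclideanSpace ℝ (Fin 3)) :
    Continuous fun p : EuclideanSpace ℝ (Fin 3) × EuclideanSpace ℝ (Fin 3) =>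
      (fderiv ℝ (fderiv ℝ (newtonFar r₀ r₁)) (p.1 - p.2) - fderiv ℝ (fderiv ℝ (newtonFar r₀ r₁)) (x₀ - p.2)) (V p.2) (V p.2) := by
  have hKc : Continuous (fderiv ℝ (fderiv ℝ (newtonFar r₀ r₁))) :=
    (contDiff_fderiv2_newtonFar h₀ h₁).continuous
  exact (((hKc.comp (continuous_fst.sub continuous_snd)).sub
    (hKc.comp (continuous_const.sub continuous_snd))).clm_apply (hV.comp continuous_snd)).clm_apply (hV.comp continuous_snd)

/-- **Absolute convergence under the velocity budget**: for continuous `V` with `∫_{B_R}|V|² ≤ A R^{1−2ρ}` (`R ≥ 1`, `ρ > −3/2`) the renormalised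
far integrand `(D²Γ∞(x−y) − D²Γ∞(x₀−y))(V y, V y)` is integrable in `y`, at every `x` and every base point `x₀` (boundedness of `V`, as in the tree's
`integrable_farPotentialMod_integrand`, is replaced by `(1+|y|)⁻⁴|V|² ∈ L¹`). [cite: Seregin2014, §6.2 Lemma 6.5] -/
theorem integrable_farIntegrand_of_budget (h₀ : 0 < r₀) (h₁ : r₀ < r₁)
    {V : EuclideanSpace ℝ (Fin 3) → EuclideanSpace ℝ (Fin 3)} (hV : Continuous V) {ρ A : ℝ} (hρ : -3 / 2 < ρ)
    (hA : ∀ R : ℝ, 1 ≤ R → ∫ y in ball (0 : EuclideanSpace ℝ (Fin 3)) R, ‖V y‖ ^ 2 ≤ A * R ^ (1 - 2 * ρ))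
    (x₀ x : EuclideanSpace ℝ (Fin 3)) :
    Integrable fun y => (fderiv ℝ (fderiv ℝ (newtonFar r₀ r₁)) (x - y) -
      fderiv ℝ (fderiv ℝ (newtonFar r₀ r₁)) (x₀ - y)) (V y) (V y) := by
  obtain ⟨M, hM0, hM⟩ := exists_norm_farIntegrand_le h₀ h₁
  set ρ' := max ‖x‖ ‖x₀‖ with hρ'
  refine Integrable.mono'
    ((integrable_normSq_weight_of_budget hV hρ hA).const_mul (M * (1 + ρ') ^ 4 * ‖x - x₀‖))
    (continuous_farIntegrand h₀ h₁ hV x₀ x).aestronglyMeasurable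
    (Eventually.of_forall fun y => hM V ρ' x x₀ y (le_max_left _ _) (le_max_right _ _))

/-- **Continuity of the renormalised far potential under the velocity budget**: `x ↦ farPotentialMod r₀ r₁ x₀ V x` is continuous (dominated convergence
on unit balls against `(1+|y|)⁻⁴|V|²`). [cite: Seregin2014, §6.2 Lemma 6.5] -/
theorem continuous_farPotentialMod_of_budget (h₀ : 0 < r₀) (h₁ : r₀ < r₁)
    {V : EuclideanSpace ℝ (Fin 3) → EuclideanSpace ℝ (Fin 3)} (hV : Continuous V) {ρ A : ℝ} (hρ : -3 / 2 < ρ)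
    (hA : ∀ R : ℝ, 1 ≤ R → ∫ y in ball (0 : EuclideanSpace ℝ (Fin 3)) R, ‖V y‖ ^ 2 ≤ A * R ^ (1 - 2 * ρ))
    (x₀ : EuclideanSpace ℝ (Fin 3)) :
    Continuous (farPotentialMod r₀ r₁ x₀ V) := by
  obtain ⟨M, hM0, hM⟩ := exists_norm_farIntegrand_le h₀ h₁
  have hW := integrable_normSq_weight_of_budget hV hρ hA
  refine continuous_iff_continuousAt.2 fun x₁ => ?_
  set ρ' := max (‖x₁‖ + 1) ‖x₀‖ with hρ'
  have hρ0 : 0 ≤ ρ' := le_max_of_le_left (by positivity)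
  unfold farPotentialMod
  refine continuousAt_of_dominated
    (bound := fun y => M * (1 + ρ') ^ 4 * (2 * ρ') * (‖V y‖ ^ 2 * ((1 + ‖y‖) ^ 4)⁻¹)) ?_ ?_ (hW.const_mul _) ?_
  · exact Eventually.of_forall fun x => (continuous_farIntegrand h₀ h₁ hV x₀ x).aestronglyMeasurable
  · have hball : ball x₁ 1 ∈ 𝓝 x₁ := ball_mem_nhds x₁ one_pos
    filter_upwards [hball] with x hx
    rw [mem_ball_iff_norm] at hx
    have hxρ : ‖x‖ ≤ ρ' := by
      have : ‖x‖ ≤ ‖x - x₁‖ + ‖x₁‖ := norm_le_norm_sub_add x x₁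
      exact le_max_of_le_left (by linarith)
    have hx₀ρ : ‖x₀‖ ≤ ρ' := le_max_right _ _
    refine Eventually.of_forall fun y => (hM V ρ' x x₀ y hxρ hx₀ρ).trans ?_
    have hxx : ‖x - x₀‖ ≤ 2 * ρ' := (norm_sub_le x x₀).trans (by linarith)
    have h4 : 0 ≤ ‖V y‖ ^ 2 * ((1 + ‖y‖) ^ 4)⁻¹ := by positivity
    exact mul_le_mul_of_nonneg_right (mul_le_mul_of_nonneg_left hxx (by positivity)) h4
  · refine Eventually.of_forall fun y => ?_
    have hc : Continuous fun x => (fderiv ℝ (fderiv ℝ (newtonFar r₀ r₁)) (x - y) -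
        fderiv ℝ (fderiv ℝ (newtonFar r₀ r₁)) (x₀ - y)) (V y) (V y) :=
      ((((contDiff_fderiv2_newtonFar h₀ h₁).continuous.comp (continuous_id.sub continuous_const)).sub
        continuous_const).clm_apply continuous_const).clm_apply continuous_const
    exact hc.continuousAt

end Summit.NavierStokesRegularity.NavierStokesRegularity.Theorems.PowerGaugeEulerLiouville.PressureSeam

end
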